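import Summits.HodgeConjecture.HodgeConjecture.Theorems.MarkmanPartnerTransportK3Sq2OneCycle
import Summits.HodgeConjecture.HodgeConjecture.Theorems.MarkmanPartnerTransportPartnerTransportIsometry
import Literature.AlgebraicGeometry.Motives.HodgeStructureK3TypeIsometrySpan

/-!
# Route MarkmanPartnerTransport · crux #5 `LowPicardRealMultiplication` — complex multiplication on a marked
# `K3^{[2]}`-type fourfold forces `SpannedByIsometries`

The crux `LowPicardRealMultiplication` carries the hypothesis `¬ SpannedByIsometries X φ` (the isometry-spanned
sector is item #3 `IsometrySpannedThird`, proved modulo {Verbitsky–Guan, Charles–Markman, Markman 2024}). This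
file proves, on the period datum of a marked smooth projective `K3^{[2]}`-type `X` (`…K3Sq2PeriodDatum`,
`…LatticeBridge*`), that **complex multiplication forces `SpannedByIsometries`**: if some rational endomorphism
`Ψ` of `H²(X(ℂ); ℂ)` preserving type `(1,1)` has a NON-REAL eigenvalue on `σ = φ⁻¹ z` (`CMX`, the second
alternative of the one-cycle engine `generatedBy_or_cm_of_criterion`), then `Ψ|_T ∈ E = End_Hdg(T(X)_ℚ)` has a
non-real `(2,0)`-character value, so `E` is a CM field spanned over `ℚ` by its Hodge ISOMETRIES (the tree's
`span_setOf_isometry_eq_top_of_conj_ne`, Zarhin Thm. 1.6 / Huybrechts Thm. 3.3.7); each isometry `u` of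
`(T, q|_T)` extended by `id_N` (`extendT`) complexifies to a bijective, rational, type-preserving `q`-isometry of
`H²(X)` (`typePreserving_of_markedSq`: `(2,0)` by the eigenvector, `(1,1)` by (m5), `(0,2)` by conjugation), and
every rational Hodge endomorphism of `H²(X)` is their `ℚ`-combination on `T(X)` — VERBATIM the clause
`SpannedByIsometries X φ` of the route declarations (`spannedByIsometries_of_cm`). Consequence (sequel
`…K3Sq2OneCycleFifth`): under `¬ SpannedByIsometries` the one-cycle engine's CM alternative is excluded, so
crux #5 reduces BY NAME to a one-cycle clause. No definition, no sorry, no named-fact hypothesis.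
Prover seat hodge-nonav-19652-p1 (gen 8), `--supports stmt-HodgeConjecture-19653`.

References: Zarhin, J. reine angew. Math. 341 (1983) Thm. 1.5.1, Thm. 1.6; Huybrechts, *Lectures on K3 Surfaces*,
Ch. 3 Thm. 3.3.7, Cor. 3.3.6; Voisin, *Hodge Theory I*, Cor. 6.12.
-/

noncomputable section

set_option linter.dupNamespace false

open scoped TensorProduct
open Module CategoryTheory
open Literature.AlgebraicTopology.SingularHomology Literature.Geometry.Kaehler
open Literature.AlgebraicGeometry Literature.AlgebraicGeometry.Motives Literature.AlgebraicGeometry.HodgeTheory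
open Literature.AlgebraicGeometry.Motives.HodgeStructure
open Literature.AlgebraicGeometry.Hyperkaehler Literature.AlgebraicGeometry.Surfaces
open Summit.HodgeConjecture.HodgeConjecture.Theorems.NikulinTwinTransport
open Summit.HodgeConjecture.HodgeConjecture.Theorems.MarkmanPartnerTransport.BBFPositivity
open Summit.HodgeConjecture.HodgeConjecture.Theorems.MarkmanPartnerTransport.LatticeBridge

namespace Summit.HodgeConjecture.HodgeConjecture.Theorems.MarkmanPartnerTransport.PartnerLattice

/-- `MarkedK3Sq[X, φ, P, z]`: VERBATIM the `let MarkedK3Sq := …` binder of the route declarations of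
MarkmanPartnerTransport (clauses (m1)–(m6)). Local notation only. -/
local notation3 (prettyPrint := false) "MarkedK3Sq[" X ", " φ ", " P ", " z "]" =>
  (((IsIntegralClass P ∧ ∀ Q : complexBetti X (2 * 4), IsIntegralClass Q → ∃ n : ℤ, Q = n • P) ∧
    (∀ c : complexBetti X 2, IsIntegralClass c ↔ ∃ v : K3HilbertIndex → ℤ, φ c = fun i => (v i : ℂ)) ∧
    (∀ a : complexBetti X 2, cupPowTwo a 4 = ((3 : ℂ) * (k3HilbertForm 2 (φ a) (φ a)) ^ 2) • P) ∧
    (IsOfHodgeType 4 X 2 2 0 (LinearEquiv.symm φ z) ∧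
      ∀ τ : complexBetti X 2, IsOfHodgeType 4 X 2 2 0 τ → ∃ t : ℂ, τ = t • LinearEquiv.symm φ z) ∧
    (∀ c : complexBetti X 2, IsOfHodgeType 4 X 2 1 1 c ↔
      (k3HilbertForm 2 (φ c) z = 0 ∧ k3HilbertForm 2 (φ c) (star z) = 0)) ∧
    (k3HilbertForm 2 z z = 0 ∧ 0 < (k3HilbertForm 2 (star z) z).re)))

/-- `SpIso[X, φ]`: VERBATIM the `let SpannedByIsometries := …` binder of the route declarations (with
`IsBBFTransc` unfolded): every rational Hodge endomorphism of `H²(X)` killing `N¹(X)` with `q`-transcendental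
image is, on `T(X)`, a `ℚ`-combination of bijective rational type-preserving `q`-isometries. Local notation only. -/
local notation3 (prettyPrint := false) "SpIso[" X ", " φ "]" =>
  (∀ f : complexBetti X 2 →ₗ[ℂ] complexBetti X 2, (∀ y, IsRationalClass y → IsRationalClass (f y)) →
    (∀ (i j : ℕ) y, IsOfHodgeType 4 X 2 i j y → IsOfHodgeType 4 X 2 i j (f y)) →
    (∀ d : complexBetti X 2, d ∈ algebraicClasses X 1 → f d = 0) →
    (∀ y : complexBetti X 2, ∀ d : complexBetti X 2, d ∈ algebraicClasses X 1 →
      k3HilbertForm 2 (φ (f y)) (φ d) = 0) →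
    ∃ (k : ℕ) (c : Fin k → ℚ) (g : Fin k → (complexBetti X 2 →ₗ[ℂ] complexBetti X 2)),
      (∀ i, Function.Bijective (g i) ∧ (∀ y, IsRationalClass y → IsRationalClass (g i y)) ∧
        (∀ (a b : ℕ) y, IsOfHodgeType 4 X 2 a b y → IsOfHodgeType 4 X 2 a b (g i y)) ∧
        (∀ a b, k3HilbertForm 2 (φ (g i a)) (φ (g i b)) = k3HilbertForm 2 (φ a) (φ b))) ∧
      ∀ y : complexBetti X 2, (∀ d : complexBetti X 2, d ∈ algebraicClasses X 1 →
        k3HilbertForm 2 (φ y) (φ d) = 0) → f y = ∑ i : Fin k, ((c i : ℂ) • g i y))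

/-- `qQ`: the rational Beauville–Bogomolov form on `ℚ²³`. -/
local notation3 (prettyPrint := false) "qQ" => Matrix.toBilin' (Matrix.map (k3HilbertGram 2) (Int.cast : ℤ → ℚ))

/-- `qC`: the complex Beauville–Bogomolov form on `ℂ²³`. -/
local notation3 (prettyPrint := false) "qC" => Matrix.toBilin' (Matrix.map (k3HilbertGram 2) (Int.cast : ℤ → ℂ))

variable {X : SchemeOver ℂ} {φ : complexBetti X 2 ≃ₗ[ℂ] (K3HilbertIndex → ℂ)} {P : complexBetti X (2 * 4)}
  {z : K3HilbertIndex → ℂ}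

/-! ### Type preservation from the three lines -/

/-- **Type preservation in the marking picture**: for a REAL endomorphism `M` of `ℂ²³` (`M z̄' = \overline{M z'}`)
with the period `z` as eigenvector and preserving `{z, z̄}^⊥`, the endomorphism `φ⁻¹ ∘ M ∘ φ` of `H²(X(ℂ); ℂ)`
preserves every Hodge type: `(2,0)` by (m4), `(1,1)` by (m5), `(0,2)` by conjugation (Voisin Cor. 6.12 and the
reality of the marking), and `H²` has no other types. [cite: VoisinHodgeI2002, §6.1.3 Cor. 6.12]
[cite: Huybrechts2016K3, Ch. 3 §2.2] -/
theorem typePreserving_of_markedSq (hX : IsSmoothProjective 4 X) (hM : MarkedK3Sq[X, φ, P, z])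
    (M : Module.End ℂ (K3HilbertIndex → ℂ)) (hMstar : ∀ w, M (star w) = star (M w)) (hMz : ∃ c : ℂ, M z = c • z)
    (hM11 : ∀ w : K3HilbertIndex → ℂ, k3HilbertForm 2 w z = 0 → k3HilbertForm 2 w (star z) = 0 →
      k3HilbertForm 2 (M w) z = 0 ∧ k3HilbertForm 2 (M w) (star z) = 0)
    (i j : ℕ) (y : complexBetti X 2) (hy : IsOfHodgeType 4 X 2 i j y) :
    IsOfHodgeType 4 X 2 i j (φ.symm (M (φ y))) := by
  obtain ⟨-, hint, -, ⟨hz20, hz20'⟩, h11, -⟩ := id hM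
  obtain ⟨c, hc⟩ := hMz
  have hconj : ∀ y : complexBetti X 2, φ.symm (M (φ (conjClass (ComplexPoints X) 2 y))) =
      conjClass (ComplexPoints X) 2 (φ.symm (M (φ y))) := by
    intro y
    apply φ.injective
    rw [LinearEquiv.apply_symm_apply, marking_conjClass hint, hMstar, marking_conjClass hint,
      LinearEquiv.apply_symm_apply]
  have h20 : ∀ y, IsOfHodgeType 4 X 2 2 0 y → IsOfHodgeType 4 X 2 2 0 (φ.symm (M (φ y))) := by
    intro y hy
    obtain ⟨s, rfl⟩ := hz20' y hy
    rw [map_smul, LinearEquiv.apply_symm_apply, map_smul, hc, map_smul, map_smul]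
    exact (hz20.smul c).smul s
  by_cases hij : i + j = 2
  · have hi2 : i ≤ 2 := by omega
    interval_cases i
    · -- `(0,2)`: by conjugation
      obtain rfl : j = 2 := by omega
      rw [← conjClass_conjClass (φ.symm (M (φ y))), ← hconj]
      exact (h20 _ (hy.conjClass hX)).conjClass hX
    · -- `(1,1)`
      obtain rfl : j = 1 := by omega
      obtain ⟨h1, h2⟩ := (h11 y).1 hy
      rw [h11, LinearEquiv.apply_symm_apply]
      exact hM11 (φ y) h1 h2
    · -- `(2,0)`
      obtain rfl : j = 0 := by omega
      exact h20 y hy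
  · -- no classes of type `(i, j)`, `i + j ≠ 2`, in `H²`
    have hy0 : y = 0 := by
      obtain ⟨A, hA⟩ := hy
      rw [(A.hodgePQ_eq_bot_iff 2 i j).2
          (Literature.NumberTheory.Transcendental.hodgePQ_eq_bot_of_ne (M := A.carrier) hij),
        Submodule.mem_bot] at hA
      exact A.pullback_injective 2 (by rw [hA, map_zero])
    rw [hy0, map_zero, map_zero, map_zero]
    exact isOfHodgeType_zero_of_isSmoothProjective nonempty_hodgeModel_holds hX 2 i j

/-! ### Reading an endomorphism with the period as eigenvector and preserving type `(1,1)` -/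

/-- **Reading lemma, `(2,0) + (1,1)` form**: a rational endomorphism `G` of `H²(X(ℂ); ℂ)` with `σ = φ⁻¹z` as an
eigenvector and preserving type `(1,1)` is, in coordinates, the complexification of a rational endomorphism of
`ℚ²³` with `z` as eigenvector preserving `{z, z̄}^⊥` (as `exists_ratEnd_of_hodgeEndomorphism`, with exactly the
hypotheses it uses). [cite: VoisinHodgeI2002, §7.1.1] [cite: Huybrechts2016K3, Ch. 3 §2.2] -/
theorem exists_ratEnd_of_eigen_of_oneOne (hX : IsSmoothProjective 4 X) (hM : MarkedK3Sq[X, φ, P, z])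
    (G : complexBetti X 2 →ₗ[ℂ] complexBetti X 2) (hG_rat : ∀ y, IsRationalClass y → IsRationalClass (G y))
    (hGσ : ∃ c : ℂ, G (φ.symm z) = c • φ.symm z)
    (hG11 : ∀ y, IsOfHodgeType 4 X 2 1 1 y → IsOfHodgeType 4 X 2 1 1 (G y)) :
    ∃ τ : Module.End ℚ (K3HilbertIndex → ℚ),
      cxEnd τ = φ.toLinearMap ∘ₗ G ∘ₗ φ.symm.toLinearMap ∧ (∃ c : ℂ, cxEnd τ z = c • z) ∧
      ∀ w : K3HilbertIndex → ℂ, k3HilbertForm 2 w z = 0 → k3HilbertForm 2 w (star z) = 0 →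
        k3HilbertForm 2 (cxEnd τ w) z = 0 ∧ k3HilbertForm 2 (cxEnd τ w) (star z) = 0 := by
  obtain ⟨-, hint, -, -, h11, -⟩ := id hM
  set Mφ : Module.End ℂ (K3HilbertIndex → ℂ) := φ.toLinearMap ∘ₗ G ∘ₗ φ.symm.toLinearMap with hMdef
  have hMapp : ∀ w, Mφ w = φ (G (φ.symm w)) := fun w => rfl
  have hrat : ∀ v : K3HilbertIndex → ℤ, ∃ w : K3HilbertIndex → ℚ, Mφ (fun i => (v i : ℂ)) = fun i => (w i : ℂ) := by
    intro v
    have hc : IsRationalClass (φ.symm fun i => (v i : ℂ)) :=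
      ((hint _).2 ⟨v, φ.apply_symm_apply _⟩).isRationalClass
    obtain ⟨w, hw⟩ := (isRationalClass_iff_of_markedSq hX hint _).1 (hG_rat _ hc)
    exact ⟨w, by rw [hMapp, hw]⟩
  obtain ⟨τ, hτ⟩ := exists_ratEnd_of_forall_intCast' Mφ hrat
  have hMτ : Mφ = cxEnd τ := eq_cxEnd_of_forall hτ
  refine ⟨τ, hMτ.symm, ?_, ?_⟩
  · obtain ⟨t, ht⟩ := hGσ
    exact ⟨t, by rw [← hMτ, hMapp, ht, map_smul, LinearEquiv.apply_symm_apply]⟩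
  · intro w hwz hwz'
    have hw11 : IsOfHodgeType 4 X 2 1 1 (φ.symm w) := (h11 _).2 (by rw [LinearEquiv.apply_symm_apply]; exact ⟨hwz, hwz'⟩)
    have h := (h11 _).1 (hG11 _ hw11)
    rw [← hMτ, hMapp]
    exact h

/-! ### Complex multiplication forces `SpannedByIsometries` -/

/-- **Complex multiplication forces `SpannedByIsometries`** (module docstring): from a rational endomorphism
`Ψ` preserving type `(1,1)` with `Ψ σ = μ σ`, `μ ∉ ℝ`, the endomorphism field `E = End_Hdg(T(X)_ℚ)` of the period
datum has a non-real `(2,0)`-character value, hence is spanned by Hodge isometries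
(`span_setOf_isometry_eq_top_of_conj_ne`); their extensions by `id_N` complexify to bijective rational
type-preserving `q`-isometries of `H²(X)` spanning every rational Hodge endomorphism on `T(X)`.
[cite: Zarhin1983HodgeGroupsK3, Thm. 1.5.1 and Thm. 1.6] [cite: Huybrechts2016K3, Ch. 3 Thm. 3.3.7 and Cor. 3.3.6] -/
theorem spannedByIsometries_of_cm (hX : IsSmoothProjective 4 X) (hM : MarkedK3Sq[X, φ, P, z])
    (Ψ : complexBetti X 2 →ₗ[ℂ] complexBetti X 2) (hΨrat : ∀ y, IsRationalClass y → IsRationalClass (Ψ y))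
    (hΨ11 : ∀ y, IsOfHodgeType 4 X 2 1 1 y → IsOfHodgeType 4 X 2 1 1 (Ψ y)) {μ : ℂ}
    (hΨσ : Ψ (φ.symm z) = μ • φ.symm z) (hμ : μ.im ≠ 0) : SpIso[X, φ] := by
  classical
  obtain ⟨-, hint, -, ⟨hz20, hz20'⟩, h11, hzz, hzpos⟩ := id hM
  obtain ⟨NQ, hNQ⟩ := exists_ratNeronSeveri (X := X) φ
  set D := periodDatum hX hM hNQ with hDdef
  have hDT : D.T = (qQ).orthogonal NQ := rfl
  have hDx : D.x = z := rfl
  have hDBC : ∀ a b, D.BC a b = k3HilbertForm 2 a b := fun a b => qC_apply a b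
  clear_value D
  have hzne : z ≠ 0 := by
    intro h0
    rw [h0, k3HilbertForm_eq_dotProduct] at hzpos
    simp at hzpos
  set H := D.hodgeT with hH
  have hK3 : H.IsOfK3Type := D.isOfK3Type_hodgeT
  have hirr : H.IsIrreducible := D.isIrreducible_hodgeT
  set ψ : H.Polarization := D.polT with hψ
  obtain ⟨hFld, ε, hεinj, hε⟩ := Zarhin1983_endAlg_isField_holds H hirr hK3
  have hω : D.omega ∈ H.piece 2 0 := D.omega_mem_piece
  have hrat : ∀ c, IsRationalClass c ↔ ∃ w : K3HilbertIndex → ℚ, φ c = fun i => (w i : ℂ) :=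
    isRationalClass_iff_of_markedSq hX hint
  -- reading an endomorphism with `σ` as eigenvector and preserving `(1,1)` in `E`, with its `ε`-value
  have read : ∀ (G : complexBetti X 2 →ₗ[ℂ] complexBetti X 2) (c : ℂ),
      (∀ y, IsRationalClass y → IsRationalClass (G y)) → G (φ.symm z) = c • φ.symm z →
      (∀ y, IsOfHodgeType 4 X 2 1 1 y → IsOfHodgeType 4 X 2 1 1 (G y)) →
      ∃ (τ : Module.End ℚ (K3HilbertIndex → ℚ)) (hτT : ∀ t ∈ D.T, τ t ∈ D.T) (hr : τ.restrict hτT ∈ H.endAlg),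
        cxEnd τ = φ.toLinearMap ∘ₗ G ∘ₗ φ.symm.toLinearMap ∧ ε ⟨τ.restrict hτT, hr⟩ = c := by
    intro G c hG_rat hGσ hG11
    obtain ⟨τ, hτM, hτx, hτ11⟩ := exists_ratEnd_of_eigen_of_oneOne hX hM G hG_rat ⟨c, hGσ⟩ hG11
    have hτx' : ∃ c : ℂ, cxEnd τ D.x = c • D.x := by rw [hDx]; exact hτx
    have hτ11' : ∀ w : K3HilbertIndex → ℂ, D.BC w D.x = 0 → D.BC w (star D.x) = 0 →
        D.BC (cxEnd τ w) D.x = 0 ∧ D.BC (cxEnd τ w) (star D.x) = 0 := by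
      intro w h1 h2
      rw [hDBC, hDx] at h1 h2
      rw [hDBC, hDBC, hDx]
      exact hτ11 w h1 h2
    have hτT : ∀ t ∈ D.T, τ t ∈ D.T := fun t ht => D.map_mem_T τ hτx' ht
    have hr : τ.restrict hτT ∈ H.endAlg := D.restrict_mem_endAlg τ hτT hτx' hτ11'
    have hτMapp : ∀ v, cxEnd τ v = φ (G (φ.symm v)) := fun v => by rw [hτM]; rfl
    refine ⟨τ, hτT, hr, hτM, ?_⟩
    have h := hε ⟨τ.restrict hτT, hr⟩ D.omega hω
    have h2 := congrArg (iota D.T) h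
    have hval : ((⟨τ.restrict hτT, hr⟩ : H.endAlg) : Module.End ℚ ↥D.T) = τ.restrict hτT := rfl
    rw [hval, D.iota_baseChange_restrict τ hτT, D.iota_omega, map_smul, D.iota_omega, hDx, hτMapp, hGσ, map_smul,
      LinearEquiv.apply_symm_apply] at h2
    have h3 : (c - ε ⟨τ.restrict hτT, hr⟩) • z = 0 := by rw [sub_smul, h2, sub_self]
    rcases smul_eq_zero.1 h3 with h4 | h4
    · exact (sub_eq_zero.1 h4).symm
    · exact absurd h4 hzne
  -- `E` is a CM field, spanned by isometries
  obtain ⟨τΨ, hτΨT, hrΨ, -, hεΨ⟩ := read Ψ μ hΨrat hΨσ hΨ11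
  have hCM : ∃ (φ' : H.endAlg →+* ℂ) (a : H.endAlg), starRingEnd ℂ (φ' a) ≠ φ' a := by
    refine ⟨ε.toRingHom, ⟨τΨ.restrict hτΨT, hrΨ⟩, fun h => hμ ?_⟩
    change starRingEnd ℂ (ε ⟨τΨ.restrict hτΨT, hrΨ⟩) = ε ⟨τΨ.restrict hτΨT, hrΨ⟩ at h
    rw [hεΨ] at h
    exact Complex.conj_eq_iff_im.1 h
  have hspan := span_setOf_isometry_eq_top_of_conj_ne hirr hK3 ψ hCM
  -- the goal
  intro f hf_rat hf_typ _ _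
  obtain ⟨t, ht⟩ := hz20' _ (hf_typ 2 0 _ hz20)
  obtain ⟨τf, hτfT, hrf, hτfM, -⟩ := read f t hf_rat ht (fun y hy => hf_typ 1 1 y hy)
  have hτfMapp : ∀ v, cxEnd τf v = φ (f (φ.symm v)) := fun v => by rw [hτfM]; rfl
  have hmem : (⟨τf.restrict hτfT, hrf⟩ : H.endAlg) ∈ Submodule.span ℚ {u : H.endAlg |
      ∀ v w : ↥D.T, ψ.form ((u : Module.End ℚ ↥D.T) v) ((u : Module.End ℚ ↥D.T) w) = ψ.form v w} := by
    rw [hspan]; exact Submodule.mem_top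
  obtain ⟨n, c, u, hsum⟩ := Submodule.mem_span_set'.1 hmem
  -- the isometries `u i` of `(T, q|_T)` and their extensions `û i` by `id_N`
  have hiso : ∀ (i : Fin n) (v w : ↥D.T),
      D.B (((u i : H.endAlg) : Module.End ℚ ↥D.T) v) (((u i : H.endAlg) : Module.End ℚ ↥D.T) w) = D.B v w := by
    intro i v w
    have h : ∀ v w : ↥D.T, ψ.form (((u i : H.endAlg) : Module.End ℚ ↥D.T) v)
        (((u i : H.endAlg) : Module.End ℚ ↥D.T) w) = ψ.form v w := (u i).2
    have h' := h v w
    change (-(D.B.restrict D.T)) _ _ = (-(D.B.restrict D.T)) _ _ at h'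
    rw [LinearMap.neg_apply, LinearMap.neg_apply, LinearMap.neg_apply, LinearMap.neg_apply, neg_inj,
      LinearMap.BilinForm.restrict_apply, LinearMap.domRestrict_apply, LinearMap.BilinForm.restrict_apply,
      LinearMap.domRestrict_apply] at h'
    exact h'
  obtain ⟨û, hûdef⟩ : ∃ û : Fin n → Module.End ℚ (K3HilbertIndex → ℚ),
      ∀ i, û i = D.extendT ((u i : H.endAlg) : Module.End ℚ ↥D.T) := ⟨_, fun i => rfl⟩
  have hûiso : ∀ i (v w : K3HilbertIndex → ℚ), D.B (û i v) (û i w) = D.B v w := fun i v w => by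
    rw [hûdef]
    exact D.B_extendT _ (hiso i) v w
  have hûz : ∀ i, ∃ c : ℂ, cxEnd (û i) z = c • z := fun i => by
    have h := D.cxEnd_extendT_period (u := ((u i : H.endAlg) : Module.End ℚ ↥D.T)) (u i : H.endAlg).2
    rwa [hDx, ← hûdef] at h
  have hû11 : ∀ i (w : K3HilbertIndex → ℂ), k3HilbertForm 2 w z = 0 → k3HilbertForm 2 w (star z) = 0 →
      k3HilbertForm 2 (cxEnd (û i) w) z = 0 ∧ k3HilbertForm 2 (cxEnd (û i) w) (star z) = 0 := by
    intro i w h1 h2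
    have h := D.BC_cxEnd_extendT (u i : H.endAlg).2 (z := w) (by rw [hDBC, hDx]; exact h1) (by rw [hDBC, hDx]; exact h2)
    rwa [hDBC, hDBC, hDx, ← hûdef] at h
  obtain ⟨g, hgdef⟩ : ∃ g : Fin n → (complexBetti X 2 →ₗ[ℂ] complexBetti X 2),
      ∀ i, g i = φ.symm.toLinearMap ∘ₗ cxEnd (û i) ∘ₗ φ.toLinearMap := ⟨_, fun i => rfl⟩
  have hgapp : ∀ i y, g i y = φ.symm (cxEnd (û i) (φ y)) := fun i y => by rw [hgdef]; rfl
  refine ⟨n, c, g, fun i => ⟨?_, ?_, ?_, ?_⟩, fun y hy => ?_⟩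
  · -- bijective: `û i` is an isometry of the non-degenerate `q`, hence a unit, and so is its complexification
    have hinj : Function.Injective (û i) := by
      rw [injective_iff_map_eq_zero]
      intro v hv
      exact D.nondegenerate.1 v fun w => by rw [← hûiso i, hv, LinearMap.BilinForm.zero_left]
    have hunit : IsUnit (û i) := (Module.End.isUnit_iff _).2 ⟨hinj, LinearMap.injective_iff_surjective.1 hinj⟩
    have hcx : Function.Bijective (cxEnd (û i)) := (Module.End.isUnit_iff _).1 (by
      have h := hunit.map cxEndHom
      rwa [cxEndHom_apply] at h)
    rw [hgdef]
    exact (φ.symm.bijective.comp hcx).comp φ.bijective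
  · -- rational
    intro y hy
    obtain ⟨w, hw⟩ := (hrat y).1 hy
    rw [hgapp, hw, cxEnd_ratVec]
    exact (hrat _).2 ⟨û i w, LinearEquiv.apply_symm_apply _ _⟩
  · -- type-preserving
    intro a b y hy
    rw [hgapp]
    exact typePreserving_of_markedSq hX hM (cxEnd (û i)) (cxEnd_star (û i)) (hûz i) (hû11 i) a b y hy
  · -- isometry
    intro a b
    rw [hgapp, hgapp, LinearEquiv.apply_symm_apply, LinearEquiv.apply_symm_apply, ← hDBC, ← hDBC]
    exact form_cxEnd D.ratCast_form (û i) (hûiso i) (φ a) (φ b)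
  · -- the sum on `T(X)`
    have h1 : (τf.restrict hτfT : Module.End ℚ ↥D.T) = ∑ i, c i • ((u i : H.endAlg) : Module.End ℚ ↥D.T) := by
      have h := congrArg (fun s : H.endAlg => (s : Module.End ℚ ↥D.T)) hsum
      simp only [AddSubmonoidClass.coe_finsetSum, Subalgebra.coe_smul] at h
      exact h.symm
    have hTeq : ∀ t' : ↥D.T, τf (t' : K3HilbertIndex → ℚ) = ∑ i, c i • û i (t' : K3HilbertIndex → ℚ) := by
      intro t'
      have h2 := congrArg Subtype.val (LinearMap.congr_fun h1 t')
      rw [LinearMap.coe_restrict_apply, LinearMap.sum_apply, Submodule.coe_sum] at h2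
      rw [h2]
      refine Finset.sum_congr rfl fun i _ => ?_
      rw [LinearMap.smul_apply, Submodule.coe_smul, hûdef, D.extendT_apply_coe]
    have hcx : ∀ w : ℂ ⊗[ℚ] ↥D.T, cxEnd τf (iota _ w) = ∑ i, ((c i : ℚ) : ℂ) • cxEnd (û i) (iota _ w) := by
      intro w
      induction w using TensorProduct.induction_on with
      | zero => simp only [map_zero, smul_zero, Finset.sum_const_zero]
      | tmul a t' =>
        rw [iota_tmul, map_smul, cxEnd_ratVec, hTeq t', ratCastVec_sum, Finset.smul_sum]
        refine Finset.sum_congr rfl fun i _ => ?_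
        rw [ratCastVec_smul, ← cxEnd_ratVec, map_smul, smul_comm]
      | add z₁ z₂ h₁ h₂ =>
        rw [map_add, map_add, h₁, h₂, ← Finset.sum_add_distrib]
        refine Finset.sum_congr rfl fun i _ => ?_
        rw [map_add, smul_add]
    have hyT : φ y ∈ Submodule.span ℂ (Set.range fun t : ↥D.T => fun i => (((t : K3HilbertIndex → ℚ) i : ℚ) : ℂ)) := by
      have h := (mem_span_ratTransc_iff hX hint hNQ (φ y)).2 hy
      rw [Set.image_eq_range] at h
      rw [hDT]
      exact h
    have hz : iota _ (lam D.isCompl (φ y)) = φ y := iota_lam_of_mem_span D.isCompl hyT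
    have hfy : f y = φ.symm (cxEnd τf (φ y)) := by
      rw [hτfMapp, LinearEquiv.symm_apply_apply, LinearEquiv.symm_apply_apply]
    rw [hfy, ← hz, hcx, hz, map_sum]
    refine Finset.sum_congr rfl fun i _ => ?_
    rw [map_smul, hgapp]

end Summit.HodgeConjecture.HodgeConjecture.Theorems.MarkmanPartnerTransport.PartnerLattice

end
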